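import Literature.MathematicalPhysics.QuantumFieldTheory.Balaban1983to89.B9Eq3187Op

/-!
# `Balaban1983to89.B9Thm315Whole` — [B9] Theorem 3.15 (p. 432) AS THE WHOLE PRINTED LEAF `B9.Thm315FullPrinted`: a glue module
# over the landed Sect.-E lineage (`B9Thm315Decay`, `B9Eq3169MuN`, `B9Eq3187Op`), with the two abstract predicate slots of the
# leaf — «is given by the formula (3.185)» and «has a convergent random walk expansion» — PINNED to printed content

T. Bałaban, *Propagators for lattice gauge theories in a background field*, Commun. Math. Phys. **99** (1985) 389–434
[`Balaban1985BackgroundPropagators`, "B9"]; [4] = T. Bałaban, *Propagators and renormalization transformations for lattice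
gauge theories. II*, Commun. Math. Phys. **96** (1984) 223–250 [`Balaban1984PropagatorsII`].

statement-level skeleton of published theorems with citation tags; proofs where landed; nothing here is a claim about the
Yang–Mills mass gap

THE PRINTED LOCUS (verbatim, p. 432 [PDF 44]): *"Let us denote a covariance operator of the Gaussian integral in (3.183) by G̃₂,
then we obtain C^{(k)}(Λ) = (I + D̄μ)QG̃₂Q*(I + μ*D̄*). (3.185) It is the formula we are looking for. … We have
G̃₂ = G₂ − G₂Q̃*(Q̃G₂Q̃*)^{−1}Q̃G₂. (3.186) … This way we can express C^{(k)}(Λ) in terms of the operators of the type G′,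
(Q′G′²Q′*)^{−1}, G, (QGQ*)^{−1}. Expanding these into random walks we get a random walk expansion of C^{(k)}(Λ). The formula
(3.185) implies immediately bounds and an exponential decay. Thus we get Theorem 3.15. For Mα₀ sufficiently small the
propagator C^{(k)}(Λ) is given by the formula (3.185), and satisfies the bound |C^{(k)}(Λ; y, y′)| ≤ B₀e^{−δ₀|y−y′|}, y, y′ ∈ Λ
(3.187) with the constants B₀, δ₀ depending on d and L only. This propagator has a convergent random walk expansion of the type
described previously. Of course we have all the other consequences following from the random walk expansion."*; p. 390 [PDF 2]:
*"in this paper a norm |X| of a N × N matrix means the Hilbert–Schmidt norm"*; p. 430 (3.169) (μ(B) is local: built from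
R(V(Γ_{x,y})) along contours inside one block).

THE POINT.  The cell's typed skeleton carries Theorem 3.15 in full as `B9.Thm315FullPrinted c35 geo bg Ck inΛ unitDist GivenBy3185
HasRWExpC` = «∃ δ₀ a₀ B₀ > 0, ∀ i α₀, Mα₀ ≤ a₀ → ∀ U, (3.35) → (3.36) → GivenBy3185 i U ∧ HasRWExpC i U δ₀ ∧ (3.187)» with
`GivenBy3185`, `HasRWExpC` FREE predicate slots (at the Stage-3′(Y) pin they are free fields of the operator layer
`B9PinCarriersKLevelV1.OperatorLayerY`, whence the referee clause «with `ops` residual the leaf is junk-closable»).  The lineage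
PROVES the last printed step — (3.185) + the random-walk bound of QG̃₂Q* + the locality of I + D̄μ ⇒ (3.187) with the SAME rate
(`B9Thm315Decay.decay_3187_of_3185`, block form `B9Eq3187Op.op_decay_3187`), and the kernel bookkeeping of (3.186)
(`B9Thm315Decay.kernel_3186`) — but concludes only r1's bound-only `B9.Thm315Printed`.  THIS FILE is the glue to the FULL leaf,
in the pin pattern of `B9Thm37Whole` (seat n06-c): the letters of (3.185)–(3.186) at one member form a PARAMETER RECORD `Ops315`;
the slot «given by the formula (3.185)» is SET to the identity of block kernels `C = E·S·F` (`GivenBy3185OfOps`); the slot «has a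
convergent random walk expansion» is SET to the SUMMED content the printed proof draws from that expansion — the exponential bound
of the block kernel S = QG̃₂Q* on Λ (`HasRWExpCOfOps`; as `B9Thm37Whole.Conv342` reads Thm 3.7's convergence on the sum (3.90)).
The two pinned clauses are not independently junk-closable: S is tied to C^{(k)}(Λ) by the pinned identity, and C^{(k)}(Λ) to
the leaf's kernel `Ck` by the reading `Reads315`.

* §1 `Ops315` (letters), `GivenBy3185OfOps`, `HasRWExpCOfOps` (the pins), schemas `Reads315` (how `Ck`, `inΛ` read the letters;
  p. 390's Hilbert–Schmidt-vs-block domination constant K) and `Static315` (the (3.169) locality of E, F: range r, row mass m).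
* §2 `bound3187_of_pin` — ONE configuration: the pins + the schemas ⇒ (3.187) with δ₀ = δ (SAME rate) and B₀ = K·B₁e^{2δr}m².
* §3 ★ `thm315FullPrinted_of_3185` — THE WHOLE LEAF at the pins, from the schemas and, under the printed prefix (every member,
  0 < α₀, Mα₀ ≤ a₀, (3.35), (3.36)), the two pinned clauses as hypotheses of printed shape; `thm315FullPrinted_of_imp`
  (transport along implications of the two slots — the knit's «pinned reading» hypothesis shape); `thm315Printed_pin`.
* §4 `Static3186`, `Local3186` (the letters of (3.186) through the block set of the extended sequence {Ω_j}_{j≤k+1}, p. 429),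
  `hasRWExpC_of_3186` ((3.186)'s four block-kernel bounds ⇒ the pinned clause, by `kernel_3186` on the norm majorants),
  ★ `thm315FullPrinted_of_3186` (the leaf from (3.185) + the (3.186) letters: «express C^{(k)}(Λ) in terms of the operators
  of the type G′, (Q′G′²Q′*)^{−1}, G, (QGQ*)^{−1}»).

HONEST SCOPE.  Nothing of print is asserted: the factorisation (3.185) (its derivation (3.159)–(3.184) is finite-dimensional
δ-function bookkeeping, GAPS G-B9-17; it rests on the positivity γ₀ of C*Δ_kC asserted on p. 428, GAPS G-B9-09 — the repair LOGIC
is `B9SectEKernel.gamma0_assembly`, shared with NODE O of the DAG, CITED HERE, NOT RE-DERIVED), the random-walk bound of QG̃₂Q*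
resp. of the four letters of (3.186) (the undisplayed G₂ − G₁ perturbation, GAPS G-B9-10; kernel companion
`B9Eq3186G2Perturbation`), the locality constants r, m of (3.169) (values: `B9Eq3187Op` §4 on combs) are HYPOTHESES of printed
shape; the walk-level clause of «the type described previously» (convergent, localised terms, (3.99)-pattern) is the typer's
`B9SectDERandomWalkClauses.Thm315RWExpansionPrinted`, NOT implied by the pin chosen here (which is what the proof of (3.187) uses).
Value: kernel-checked bookkeeping — the printed leaf inhabited over the lineage's objects — NOT a node discharge, NOT summit
progress; one finite lattice programme; nothing continuum, nothing about the mass gap.  Cell `pub-ymgap` (HUMAN RULING D-0062),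
Track A node N06 [B9], N06-ASSIGNMENT v1 row 24, seat `pub-ymgap-dag-n06-m`, 2026-08-26.
-/

namespace Literature.MathematicalPhysics.QuantumFieldTheory.Balaban1983to89.B9Thm315Whole

open Finset
open B4Sect5Torus (IsPseudoDist)
open B9Eq3187Op (nrm nrm_apply op_decay_3187)
open scoped Matrix

noncomputable section

/-! ## §1 The letters of (3.185)–(3.186) at one member; the two pins; the reading and locality schemas -/

section OneMember

variable {g : B9.Geometry} {B : B9.Backgrounds} {𝔸 : Type} [NormedRing 𝔸] {P W : Type}

/-- **THE LETTERS OF (3.185)–(3.186) AT ONE FAMILY MEMBER** (one torus, k, sequence {Ω_j}, domain Λ ⊂ Λ_k), as total functions of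
the background U, with entries in a real normed ring `𝔸` (= End 𝔤: the fields of (3.155) are 𝔤-valued, p. 427; p. 390's |·| is the
block norm) over a finite index `P` (the (bond, colour) coordinates of Λ) placed on 𝔅 by `e`, and a middle carrier `W` (the block
set 𝔅̃ of the extended sequence {Ω_j}_{j≤k+1}, Ω_{k+1} = B^k(Λ), p. 429) with `pos : P → W` and its distance `ρW`:
`C U` = C^{(k)}(Λ) (3.155)/(3.185); `E U` = I + D̄μ(V), V = Ū^k ((3.169)); `F U` = I + μ*D̄*; `S U` = QG̃₂Q*; and the letters of
(3.186) sandwiched by Q ⋯ Q*: `S₁ U` = QG₂Q*, `A U` = QG₂Q̃*, `H U` = (Q̃G₂Q̃*)^{−1}, `Bm U` = Q̃G₂Q*.  A PARAMETER RECORD — nothing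
is constructed or asserted (pattern of `B9Thm37Whole.Ops`). [cite: Balaban1985BackgroundPropagators, (3.185)–(3.186) p.432 + (3.169) p.430 + (3.155) p.427] -/
structure Ops315 (g : B9.Geometry) (B : B9.Backgrounds) (𝔸 : Type) (P W : Type) where
  e : P → g.Site
  C : B.Cfg → Matrix P P 𝔸
  E : B.Cfg → Matrix P P 𝔸
  F : B.Cfg → Matrix P P 𝔸
  S : B.Cfg → Matrix P P 𝔸
  S₁ : B.Cfg → Matrix P P 𝔸
  A : B.Cfg → Matrix P W 𝔸
  H : B.Cfg → Matrix W W 𝔸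
  Bm : B.Cfg → Matrix W P 𝔸
  pos : P → W
  ρW : W → W → ℝ

variable [Fintype P]

/-- **THE PIN OF «is given by the formula (3.185)»**: at U, C^{(k)}(Λ) = (I + D̄μ)·QG̃₂Q*·(I + μ*D̄*) as an identity of block
kernels on the coordinates of Λ. [cite: Balaban1985BackgroundPropagators, Thm 3.15 (3.185) p.432] -/
def GivenBy3185OfOps (𝔬 : Ops315 g B 𝔸 P W) (U : B.Cfg) : Prop :=
  𝔬.C U = 𝔬.E U * 𝔬.S U * 𝔬.F U

omit [Fintype P] in
/-- **THE PIN OF «has a convergent random walk expansion of the type described previously»**, read — as the proof of (3.187) uses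
it («Expanding these into random walks we get a random walk expansion of C^{(k)}(Λ). The formula (3.185) implies immediately
bounds and an exponential decay») — ON THE SUM: the block kernel of S = QG̃₂Q* on Λ obeys ‖S(U; p, q)‖ ≤ B₁e^{−δ|e p − e q|}.  The
constant B₁ is a parameter of the pin, the rate δ is the slot's rate argument. [cite: Balaban1985BackgroundPropagators, Thm 3.15 p.432] -/
def HasRWExpCOfOps (𝔬 : Ops315 g B 𝔸 P W) (unitDist : g.Site → g.Site → ℝ) (B₁ : ℝ) (U : B.Cfg) (δ : ℝ) : Prop :=
  ∀ p q, ‖𝔬.S U p q‖ ≤ B₁ * Real.exp (-(δ * unitDist (𝔬.e p) (𝔬.e q)))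

omit [Fintype P] in
/-- **HOW THE LEAF'S CARRIERS READ THE LETTERS** (a hypothesis schema on the instance, like `B9Thm37GlueCor36.CoRealizes`): every site
of Λ (`inΛ`) is the place of some coordinate (`cover`), and the leaf's real kernel entry |C^{(k)}(Λ; y, y′)| at (e p, e q) is dominated
by K times the block norm ‖C(U; p, q)‖ (`dom`; K = 1 when the entry IS the block norm, K = the block order when p. 390's
Hilbert–Schmidt norm is read against the operator norm, `B9Eq3169MuN.exists_hs_le_card_mul_entry`).  Nothing asserted.
[cite: Balaban1985BackgroundPropagators, (3.187) p.432 + p.390] -/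
structure Reads315 (𝔬 : Ops315 g B 𝔸 P W) (Ck : B9.SiteKernel g B) (inΛ : g.Site → Prop) (K : ℝ) : Prop where
  cover : ∀ y, inΛ y → ∃ p, 𝔬.e p = y
  dom : ∀ (U : B.Cfg) (p q : P), |Ck.ker U (𝔬.e p) (𝔬.e q)| ≤ K * ‖𝔬.C U p q‖

/-- **THE LOCALITY OF I + D̄μ AND ITS ADJOINT** (from (3.169): μ(x), x ∈ B(y), is a linear function of B on the bonds of the contours
Γ_{y,x′} ⊂ B(y) with isometric coefficients R(V(Γ)), and D̄ has range one bond — hence, UNIFORMLY IN U, E(U) has range ≤ r and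
operator-norm row mass Σ_q‖E(U; p, q)‖ ≤ m, with r, m depending on d and L only; `B9Eq3187Op` §2–§4 computes r = L, m = 1 + 4d(L − 1)
on combs), the transposed-norm relation of the adjoint factor (‖F(U; q, p)‖ ≤ ‖E(U; p, q)‖), and |y − y′| a pseudo-distance along e.
A hypothesis schema; nothing asserted. [cite: Balaban1985BackgroundPropagators, (3.169) p.430 + (3.185) p.432] -/
structure Static315 (𝔬 : Ops315 g B 𝔸 P W) (unitDist : g.Site → g.Site → ℝ) (r m : ℝ) : Prop where
  pdist : IsPseudoDist (fun p q => unitDist (𝔬.e p) (𝔬.e q))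
  range : ∀ (U : B.Cfg) (p q : P), 𝔬.E U p q ≠ 0 → unitDist (𝔬.e p) (𝔬.e q) ≤ r
  rowMass : ∀ (U : B.Cfg) (p : P), ∑ q, ‖𝔬.E U p q‖ ≤ m
  adj : ∀ (U : B.Cfg) (q p : P), ‖𝔬.F U q p‖ ≤ ‖𝔬.E U p q‖

/-! ## §2 One configuration: the pins and the schemas give (3.187) with the SAME rate -/

/-- **(3.185) ⇒ (3.187) AT ONE CONFIGURATION, AT THE PIN** (p. 432: *"The formula (3.185) implies immediately bounds and an exponential
decay"*): the pinned identity C = E·S·F, the pinned bound ‖S(p, q)‖ ≤ B₁e^{−δ|e p − e q|}, the locality of E, F and the reading of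
`Ck` give |C^{(k)}(Λ; y, y′)| ≤ K·B₁e^{2δr}m²·e^{−δ|y − y′|} for y, y′ ∈ Λ — `B9Eq3187Op.op_decay_3187` read through e; the rate is NOT
degraded. [cite: Balaban1985BackgroundPropagators, Thm 3.15 (3.185)–(3.187) p.432] -/
theorem bound3187_of_pin {𝔬 : Ops315 g B 𝔸 P W} {Ck : B9.SiteKernel g B} {inΛ : g.Site → Prop}
    {unitDist : g.Site → g.Site → ℝ} {K r m B₁ δ : ℝ} {U : B.Cfg} (hK : 0 ≤ K) (hB₁ : 0 ≤ B₁) (hδ : 0 ≤ δ)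
    (hR : Reads315 𝔬 Ck inΛ K) (hS : Static315 𝔬 unitDist r m) (h85 : GivenBy3185OfOps 𝔬 U)
    (hRW : HasRWExpCOfOps 𝔬 unitDist B₁ U δ) :
    ∀ y y', inΛ y → inΛ y' →
      |Ck.ker U y y'| ≤ K * (B₁ * Real.exp (2 * δ * r) * m * m) * Real.exp (-(δ * unitDist y y')) := by
  intro y y' hy hy'
  obtain ⟨p, rfl⟩ := hR.cover y hy
  obtain ⟨q, rfl⟩ := hR.cover y' hy'
  have hop := op_decay_3187 (fun p q => unitDist (𝔬.e p) (𝔬.e q)) hS.pdist (𝔬.E U) (𝔬.S U) (𝔬.F U) hB₁ hδ hRW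
    (hS.range U) (hS.rowMass U) (hS.adj U) p q
  have h85' : 𝔬.C U = 𝔬.E U * 𝔬.S U * 𝔬.F U := h85
  have hC : ‖𝔬.C U p q‖ ≤ B₁ * Real.exp (2 * δ * r) * m * m * Real.exp (-(δ * unitDist (𝔬.e p) (𝔬.e q))) := by
    rw [h85']
    exact hop
  calc |Ck.ker U (𝔬.e p) (𝔬.e q)| ≤ K * ‖𝔬.C U p q‖ := hR.dom U p q
    _ ≤ K * (B₁ * Real.exp (2 * δ * r) * m * m * Real.exp (-(δ * unitDist (𝔬.e p) (𝔬.e q)))) :=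
        mul_le_mul_of_nonneg_left hC hK
    _ = K * (B₁ * Real.exp (2 * δ * r) * m * m) * Real.exp (-(δ * unitDist (𝔬.e p) (𝔬.e q))) := by ring

end OneMember

/-! ## §3 The whole printed leaf at the pins -/

section Family

variable {I : Type} {c35 : ℝ} {geo : I → B9.Geometry} {bg : I → B9.Backgrounds}
  {Ck : ∀ i, B9.SiteKernel (geo i) (bg i)} {inΛ : ∀ i, (geo i).Site → Prop}
  {unitDist : ∀ i, (geo i).Site → (geo i).Site → ℝ}

/-- **Transport of the full Theorem-3.15 leaf along implications of its two predicate slots** (bookkeeping on the typed sentence: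
`B9.Thm315FullPrinted … G H` reads the slots only as conjuncts `G i U`, `H i U δ₀`): if `G′ i U → G i U` and `H′ i U δ → H i U δ`
pointwise, the leaf at (G′, H′) gives the leaf at (G, H), same constants — the shape in which a knit carries «pinned reading»
hypotheses for abstract slots. [cite: Balaban1985BackgroundPropagators, Thm 3.15 p.432 (the typed sentence; bookkeeping)] -/
theorem thm315FullPrinted_of_imp {G G' : ∀ i, (bg i).Cfg → Prop} {H H' : ∀ i, (bg i).Cfg → ℝ → Prop}
    (hG : ∀ i U, G' i U → G i U) (hH : ∀ i U δ, H' i U δ → H i U δ)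
    (h : B9.Thm315FullPrinted c35 geo bg Ck inΛ unitDist G' H') : B9.Thm315FullPrinted c35 geo bg Ck inΛ unitDist G H := by
  obtain ⟨δ₀, a₀, B₀, hδ, ha, hB, hall⟩ := h
  refine ⟨δ₀, a₀, B₀, hδ, ha, hB, fun i α₀ hα hMa U hU hU' => ?_⟩
  obtain ⟨h1, h2, h3⟩ := hall i α₀ hα hMa U hU hU'
  exact ⟨hG i U h1, hH i U δ₀ h2, h3⟩

variable {𝔸 : Type} [NormedRing 𝔸] {P W : I → Type} [∀ i, Fintype (P i)]

/-- ★ **THEOREM 3.15 AS THE WHOLE PRINTED LEAF `B9.Thm315FullPrinted`, AT THE PINS** (p. 432: *"For Mα₀ sufficiently small the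
propagator C^{(k)}(Λ) is given by the formula (3.185), and satisfies the bound |C^{(k)}(Λ; y, y′)| ≤ B₀e^{−δ₀|y−y′|}, y, y′ ∈ Λ (3.187)
with the constants B₀, δ₀ depending on d and L only. This propagator has a convergent random walk expansion of the type described
previously."*), with the slots SET to `GivenBy3185OfOps (𝔬 i)` and `HasRWExpCOfOps (𝔬 i) (unitDist i) B₁`.  Inputs, all displayed:
per member the reading `Reads315` (constant K) and the locality `Static315` (r, m uniform — «depending on d and L only»); under
the printed prefix (every member, 0 < α₀, Mα₀ ≤ a₀, U in the classes (3.35) and (3.36)) the two pinned clauses themselves — (3.185)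
(print: from (3.159)–(3.184) and the positivity γ₀ > 0 of C*Δ_kC, p. 428, GAPS G-B9-09 = NODE O, G-B9-17) and the summed random-walk
bound of QG̃₂Q* at the uniform rate δ₁ (GAPS G-B9-10).  Output constants: δ₀ = δ₁ (the SAME rate), a₀, B₀ = K·B₁e^{2δ₁r}m².
Nothing of print asserted; NOT a node discharge. [cite: Balaban1985BackgroundPropagators, Thm 3.15 (3.185)–(3.187) p.432 + (3.169) p.430 + p.428] -/
theorem thm315FullPrinted_of_3185 (𝔬 : ∀ i, Ops315 (geo i) (bg i) 𝔸 (P i) (W i)) {K r m a₀ δ₁ B₁ : ℝ}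
    (hK : 0 < K) (hm : 0 < m) (ha₀ : 0 < a₀) (hδ₁ : 0 < δ₁) (hB₁ : 0 < B₁)
    (hR : ∀ i, Reads315 (𝔬 i) (Ck i) (inΛ i) K) (hS : ∀ i, Static315 (𝔬 i) (unitDist i) r m)
    (h : ∀ i : I, ∀ α₀ : ℝ, 0 < α₀ → (geo i).M * α₀ ≤ a₀ →
      ∀ U : (bg i).Cfg, (bg i).Reg335 c35 α₀ U → (bg i).Reg336 c35 α₀ U →
        GivenBy3185OfOps (𝔬 i) U ∧ HasRWExpCOfOps (𝔬 i) (unitDist i) B₁ U δ₁) :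
    B9.Thm315FullPrinted c35 geo bg Ck inΛ unitDist (fun i => GivenBy3185OfOps (𝔬 i))
      (fun i U δ => HasRWExpCOfOps (𝔬 i) (unitDist i) B₁ U δ) := by
  refine ⟨δ₁, a₀, K * (B₁ * Real.exp (2 * δ₁ * r) * m * m), hδ₁, ha₀,
    mul_pos hK (mul_pos (mul_pos (mul_pos hB₁ (Real.exp_pos _)) hm) hm), fun i α₀ hα hMa U hU hU' => ?_⟩
  obtain ⟨h85, hRW⟩ := h i α₀ hα hMa U hU hU'
  exact ⟨h85, hRW, bound3187_of_pin hK.le hB₁.le hδ₁.le (hR i) (hS i) h85 hRW⟩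

/-- The bound-only leaf of unit r1 (`B9.Thm315Printed`, (3.187) alone) at the same data, by `B9.thm315_bound_of_full`.
[cite: Balaban1985BackgroundPropagators, Thm 3.15 (3.187) p.432] -/
theorem thm315Printed_pin (𝔬 : ∀ i, Ops315 (geo i) (bg i) 𝔸 (P i) (W i)) {K r m a₀ δ₁ B₁ : ℝ}
    (hK : 0 < K) (hm : 0 < m) (ha₀ : 0 < a₀) (hδ₁ : 0 < δ₁) (hB₁ : 0 < B₁)
    (hR : ∀ i, Reads315 (𝔬 i) (Ck i) (inΛ i) K) (hS : ∀ i, Static315 (𝔬 i) (unitDist i) r m)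
    (h : ∀ i : I, ∀ α₀ : ℝ, 0 < α₀ → (geo i).M * α₀ ≤ a₀ →
      ∀ U : (bg i).Cfg, (bg i).Reg335 c35 α₀ U → (bg i).Reg336 c35 α₀ U →
        GivenBy3185OfOps (𝔬 i) U ∧ HasRWExpCOfOps (𝔬 i) (unitDist i) B₁ U δ₁) :
    B9.Thm315Printed c35 geo bg Ck inΛ unitDist :=
  B9.thm315_bound_of_full c35 geo bg Ck inΛ unitDist _ _ (thm315FullPrinted_of_3185 𝔬 hK hm ha₀ hδ₁ hB₁ hR hS h)

end Family

/-! ## §4 (3.186): the pinned random-walk clause from the block-kernel bounds of QG₂Q*, QG₂Q̃*, (Q̃G₂Q̃*)⁻¹, Q̃G₂Q* -/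

section Eq3186

variable {g : B9.Geometry} {B : B9.Backgrounds} {𝔸 : Type} [NormedRing 𝔸] {P W : Type} [Fintype P] [Fintype W]

omit [Fintype P] in
/-- **THE STATIC DATA OF (3.186) AT ONE MEMBER**: the distance `ρW` of the middle carrier (the block set of the extended sequence, in
which the random-walk majorants of p. 429's wavy operators decay) is a pseudo-distance with the lattice-sum profile
Σ_z e^{−(δ−δ′)ρW(w,z)} ≤ Kw at the rate gap δ − δ′ ([4] Lemma 2.1 shape), and it DOMINATES |y − y′| on Λ up to the additive constant
a (|e p − e q| ≤ ρW(pos p, pos q) + a).  Hypotheses of printed shape; nothing asserted.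
[cite: Balaban1985BackgroundPropagators, (3.186) p.432 + p.429; Balaban1984PropagatorsII, Lemma 2.1 (2.61) p.234] -/
structure Static3186 (𝔬 : Ops315 g B 𝔸 P W) (unitDist : g.Site → g.Site → ℝ) (δ δ' Kw a : ℝ) : Prop where
  pdistW : IsPseudoDist 𝔬.ρW
  profile : ∀ w : W, ∑ z : W, Real.exp (-((δ - δ') * 𝔬.ρW w z)) ≤ Kw
  cmp : ∀ p q : P, unitDist (𝔬.e p) (𝔬.e q) ≤ 𝔬.ρW (𝔬.pos p) (𝔬.pos q) + a

/-- **(3.186) AT ONE CONFIGURATION**: QG̃₂Q* = QG₂Q* − (QG₂Q̃*)(Q̃G₂Q̃*)^{−1}(Q̃G₂Q*) as block kernels (`eq`), and the four block-kernel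
bounds ‖QG₂Q*(p,q)‖ ≤ c₁e^{−δρW}, ‖QG₂Q̃*(p,z)‖ ≤ c_Ae^{−δρW}, ‖(Q̃G₂Q̃*)^{−1}(z,z′)‖ ≤ c_He^{−δρW}, ‖Q̃G₂Q*(z,q)‖ ≤ c_Be^{−δρW} — the
random-walk content («express C^{(k)}(Λ) in terms of the operators of the type G′, (Q′G′²Q′*)^{−1}, G, (QGQ*)^{−1}. Expanding these
into random walks …», p. 432; GAPS G-B9-10: the G₂ − G₁ perturbation is not displayed).  HYPOTHESES of printed shape.
[cite: Balaban1985BackgroundPropagators, (3.186) p.432] -/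
structure Local3186 (𝔬 : Ops315 g B 𝔸 P W) (U : B.Cfg) (δ c₁ cA cH cB : ℝ) : Prop where
  eq : 𝔬.S U = 𝔬.S₁ U - 𝔬.A U * 𝔬.H U * 𝔬.Bm U
  hS₁ : ∀ p q, ‖𝔬.S₁ U p q‖ ≤ c₁ * Real.exp (-(δ * 𝔬.ρW (𝔬.pos p) (𝔬.pos q)))
  hA : ∀ p z, ‖𝔬.A U p z‖ ≤ cA * Real.exp (-(δ * 𝔬.ρW (𝔬.pos p) z))
  hH : ∀ z z', ‖𝔬.H U z z'‖ ≤ cH * Real.exp (-(δ * 𝔬.ρW z z'))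
  hB : ∀ z q, ‖𝔬.Bm U z q‖ ≤ cB * Real.exp (-(δ * 𝔬.ρW z (𝔬.pos q)))

omit [Fintype P] in
/-- The norm reduction of (3.186): ‖(S₁ − A·H·B)(p, q)‖ ≤ ‖S₁(p, q)‖ + Σ_{z′}(Σ_z ‖A(p, z)‖‖H(z, z′)‖)‖B(z′, q)‖ (triangle inequality
and submultiplicativity in `𝔸`). [folklore] -/
private theorem norm_sub_mul_le (S₁ : Matrix P P 𝔸) (A : Matrix P W 𝔸) (H : Matrix W W 𝔸) (Bm : Matrix W P 𝔸) (p q : P) :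
    ‖(S₁ - A * H * Bm) p q‖ ≤ ‖S₁ p q‖ + ∑ z', (∑ z, ‖A p z‖ * ‖H z z'‖) * ‖Bm z' q‖ := by
  rw [Matrix.sub_apply]
  refine (norm_sub_le _ _).trans (add_le_add le_rfl ?_)
  simp only [Matrix.mul_apply]
  refine (norm_sum_le _ _).trans (Finset.sum_le_sum fun z' _ => ?_)
  refine (norm_mul_le _ _).trans ?_
  exact mul_le_mul_of_nonneg_right ((norm_sum_le _ _).trans (Finset.sum_le_sum fun z _ => norm_mul_le _ _))
    (norm_nonneg _)

omit [Fintype P] in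
/-- **(3.186) ⇒ THE PINNED RANDOM-WALK CLAUSE** (p. 432: the four letters' bounds give the bound of QG̃₂Q* on Λ): under `Static3186`
(rate gap δ − δ′, profile Kw, comparison constant a) and `Local3186` at U, ‖QG̃₂Q*(U; p, q)‖ ≤ e^{δ′a}(c₁ + c_Ac_Hc_BKw²)·e^{−δ′|e p − e q|},
i.e. `HasRWExpCOfOps 𝔬 unitDist (e^{δ′a}(c₁ + c_Ac_Hc_BKw²)) U δ′` — `B9Thm315Decay.kernel_3186` on the norm majorants, then the
comparison of ρW with |y − y′|. [cite: Balaban1985BackgroundPropagators, (3.186) p.432; Balaban1984PropagatorsII, (2.52)/(2.55) pp.232–233] -/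
theorem hasRWExpC_of_3186 {𝔬 : Ops315 g B 𝔸 P W} {unitDist : g.Site → g.Site → ℝ} {U : B.Cfg}
    {δ δ' Kw a c₁ cA cH cB : ℝ} (hc₁ : 0 ≤ c₁) (hcA : 0 ≤ cA) (hcH : 0 ≤ cH) (hcB : 0 ≤ cB) (hδ' : 0 ≤ δ') (hδ'δ : δ' ≤ δ)
    (hst : Static3186 𝔬 unitDist δ δ' Kw a) (hl : Local3186 𝔬 U δ c₁ cA cH cB) :
    HasRWExpCOfOps 𝔬 unitDist (Real.exp (δ' * a) * (c₁ + cA * cH * cB * Kw * Kw)) U δ' := by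
  intro p q
  have hker := B9Thm315Decay.kernel_3186 𝔬.ρW hst.pdistW 𝔬.pos (nrm (𝔬.S₁ U))
    (-Matrix.of fun p z => ‖𝔬.A U p z‖) (Matrix.of fun z z' => ‖𝔬.H U z z'‖) (Matrix.of fun z q => ‖𝔬.Bm U z q‖)
    hc₁ hcA hcH hcB hδ' hδ'δ hst.profile
    (fun p q => by rw [nrm_apply, abs_norm]; exact hl.hS₁ p q)
    (fun p z => by rw [Matrix.neg_apply, Matrix.of_apply, abs_neg, abs_norm]; exact hl.hA p z)
    (fun z z' => by rw [Matrix.of_apply, abs_norm]; exact hl.hH z z')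
    (fun z q => by rw [Matrix.of_apply, abs_norm]; exact hl.hB z q) p q
  have hx : (nrm (𝔬.S₁ U) - (-Matrix.of fun p z => ‖𝔬.A U p z‖) * (Matrix.of fun z z' => ‖𝔬.H U z z'‖) *
      (Matrix.of fun z q => ‖𝔬.Bm U z q‖)) p q = ‖𝔬.S₁ U p q‖ + ∑ z', (∑ z, ‖𝔬.A U p z‖ * ‖𝔬.H U z z'‖) * ‖𝔬.Bm U z' q‖ := by
    simp only [Matrix.sub_apply, Matrix.mul_apply, Matrix.neg_apply, Matrix.of_apply, nrm_apply, neg_mul,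
      Finset.sum_neg_distrib, sub_neg_eq_add]
  rw [hx] at hker
  have h1 : ‖𝔬.S U p q‖ ≤ (c₁ + cA * cH * cB * Kw * Kw) * Real.exp (-(δ' * 𝔬.ρW (𝔬.pos p) (𝔬.pos q))) := by
    have heq : 𝔬.S U = 𝔬.S₁ U - 𝔬.A U * 𝔬.H U * 𝔬.Bm U := hl.eq
    rw [heq]
    exact ((norm_sub_mul_le _ _ _ _ p q).trans (le_abs_self _)).trans hker
  have hc : 0 ≤ c₁ + cA * cH * cB * Kw * Kw := by
    have : 0 ≤ cA * cH * cB * Kw * Kw := by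
      rw [mul_assoc (cA * cH * cB)]
      exact mul_nonneg (mul_nonneg (mul_nonneg hcA hcH) hcB) (mul_self_nonneg Kw)
    linarith
  have h2 : Real.exp (-(δ' * 𝔬.ρW (𝔬.pos p) (𝔬.pos q))) ≤
      Real.exp (δ' * a) * Real.exp (-(δ' * unitDist (𝔬.e p) (𝔬.e q))) := by
    rw [← Real.exp_add]
    refine Real.exp_le_exp.mpr ?_
    have := mul_le_mul_of_nonneg_left (hst.cmp p q) hδ'
    rw [mul_add] at this
    linarith
  calc ‖𝔬.S U p q‖ ≤ (c₁ + cA * cH * cB * Kw * Kw) * Real.exp (-(δ' * 𝔬.ρW (𝔬.pos p) (𝔬.pos q))) := h1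
    _ ≤ (c₁ + cA * cH * cB * Kw * Kw) * (Real.exp (δ' * a) * Real.exp (-(δ' * unitDist (𝔬.e p) (𝔬.e q)))) :=
        mul_le_mul_of_nonneg_left h2 hc
    _ = Real.exp (δ' * a) * (c₁ + cA * cH * cB * Kw * Kw) * Real.exp (-(δ' * unitDist (𝔬.e p) (𝔬.e q))) := by ring

end Eq3186

section Family3186

variable {I : Type} {c35 : ℝ} {geo : I → B9.Geometry} {bg : I → B9.Backgrounds}
  {Ck : ∀ i, B9.SiteKernel (geo i) (bg i)} {inΛ : ∀ i, (geo i).Site → Prop}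
  {unitDist : ∀ i, (geo i).Site → (geo i).Site → ℝ}
  {𝔸 : Type} [NormedRing 𝔸] {P W : I → Type} [∀ i, Fintype (P i)] [∀ i, Fintype (W i)]

/-- ★ **THEOREM 3.15 AS THE WHOLE PRINTED LEAF, FROM (3.185) AND THE LETTERS OF (3.186)** (p. 432: *"This way we can express C^{(k)}(Λ)
in terms of the operators of the type G′, (Q′G′²Q′*)^{−1}, G, (QGQ*)^{−1}. Expanding these into random walks we get a random walk
expansion of C^{(k)}(Λ). The formula (3.185) implies immediately bounds and an exponential decay. Thus we get Theorem 3.15."*): the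
reading `Reads315`, the locality `Static315`, the static data `Static3186` of the middle carrier per member (uniform constants), and
— under the printed prefix — the pinned identity (3.185) together with (3.186) and its four block-kernel bounds (`Local3186`, c₁ > 0)
give `B9.Thm315FullPrinted` at the pins `GivenBy3185OfOps`, `HasRWExpCOfOps … (e^{δ′a}(c₁ + c_Ac_Hc_BKw²))` with δ₀ = δ′ and
B₀ = K·e^{δ′a}(c₁ + c_Ac_Hc_BKw²)e^{2δ′r}m².  Nothing of print asserted (GAPS G-B9-09/10/17 travel with the hypotheses); NOT a node
discharge. [cite: Balaban1985BackgroundPropagators, Thm 3.15 (3.185)–(3.187) p.432] -/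
theorem thm315FullPrinted_of_3186 (𝔬 : ∀ i, Ops315 (geo i) (bg i) 𝔸 (P i) (W i)) {K r m a₀ δ δ' Kw a c₁ cA cH cB : ℝ}
    (hK : 0 < K) (hm : 0 < m) (ha₀ : 0 < a₀) (hδ' : 0 < δ') (hδ'δ : δ' ≤ δ) (hc₁ : 0 < c₁) (hcA : 0 ≤ cA) (hcH : 0 ≤ cH)
    (hcB : 0 ≤ cB)
    (hR : ∀ i, Reads315 (𝔬 i) (Ck i) (inΛ i) K) (hS : ∀ i, Static315 (𝔬 i) (unitDist i) r m)
    (hW : ∀ i, Static3186 (𝔬 i) (unitDist i) δ δ' Kw a)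
    (h : ∀ i : I, ∀ α₀ : ℝ, 0 < α₀ → (geo i).M * α₀ ≤ a₀ →
      ∀ U : (bg i).Cfg, (bg i).Reg335 c35 α₀ U → (bg i).Reg336 c35 α₀ U →
        GivenBy3185OfOps (𝔬 i) U ∧ Local3186 (𝔬 i) U δ c₁ cA cH cB) :
    B9.Thm315FullPrinted c35 geo bg Ck inΛ unitDist (fun i => GivenBy3185OfOps (𝔬 i))
      (fun i U δ₀ => HasRWExpCOfOps (𝔬 i) (unitDist i) (Real.exp (δ' * a) * (c₁ + cA * cH * cB * Kw * Kw)) U δ₀) := by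
  have hB₁ : 0 < Real.exp (δ' * a) * (c₁ + cA * cH * cB * Kw * Kw) := by
    refine mul_pos (Real.exp_pos _) ?_
    have : 0 ≤ cA * cH * cB * Kw * Kw := by
      rw [mul_assoc (cA * cH * cB)]
      exact mul_nonneg (mul_nonneg (mul_nonneg hcA hcH) hcB) (mul_self_nonneg Kw)
    linarith
  refine thm315FullPrinted_of_3185 𝔬 hK hm ha₀ hδ' hB₁ hR hS fun i α₀ hα hMa U hU hU' => ?_
  obtain ⟨h85, hl⟩ := h i α₀ hα hMa U hU hU'
  exact ⟨h85, hasRWExpC_of_3186 hc₁.le hcA hcH hcB hδ'.le hδ'δ (hW i) hl⟩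

end Family3186

end

end Literature.MathematicalPhysics.QuantumFieldTheory.Balaban1983to89.B9Thm315Whole
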